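import Summits.Ventures.QEC.Census.CSSNormalFormK1
import HarnessLib

/-!
# Information sets avoiding a prescribed support; systematic form for a GIVEN information set; the translate of a
# minimum-weight logical (companions to `Census/CSSNormalFormK1.lean`)

LADDER-QEC (venture cell `qec`), type-10 lane, cell `(16, 1)`. qec-type-02's `CSSNormalForm.exists_normalForm` produces SOME information set
`I` of the `Z`-stabilizers and the translate `s` of that `I`. For the `(16, 1)` closure by linear programming (`Census/CSS/K1LP16X.lean`) we
need the normal form whose translate is a MINIMUM-WEIGHT logical `x`: then the LP at `(b, w) = (rank, d)` itself must be feasible. Facts proved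
here (all [folklore] linear algebra):
* `sub_logical_weight_lt`-type lemma `restrict_injective_of_minWeight`: a nonzero `Z`-stabilizer inside the support of a minimum-weight
  `Z`-logical `x` would give a lighter logical `x + c`; hence the restriction of `rs H^Z` to the zero set `T` of `x` is injective;
* `exists_infoSet_subset`: if the restriction of `rs H` to a coordinate set `T` is injective, `rs H` has an information set `I ⊆ T`
  (a maximal independent set of columns inside `T`; surjectivity from the independence of those columns);
* `card_eq_rank_of_bij`: such an `I` has `|I| = rank H`;
* `rowSpZ_reindex_eq_sysCode_of_bij`: the systematic form `{(v, vA)}` for a GIVEN information set (type-02's construction verbatim);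
* `zLogical_eq_translate`: in systematic form with translate `s` (`k = 1`), a `Z`-logical vanishing on the information block IS `(0, s)`
  (two logicals differ by a stabilizer, `index_two`), so its weight is `wt s`.
-/

namespace Summit.Ventures.QEC.Census.CSSNormalForm

open Matrix Finset Literature.InformationTheory.QuantumCodes Literature.InformationTheory.Coding

variable {RX RZ : Type*} [Fintype RX] [Fintype RZ]

section InfoSet

variable {R Q : Type*} [Fintype R] [Fintype Q] [DecidableEq Q]

omit [DecidableEq Q] in
/-- **An information set inside `T`.** If no nonzero vector of `rs H` vanishes on all of `T`, then `rs H` restricts bijectively to some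
`I ⊆ T`. [folklore] -/
theorem exists_infoSet_subset (H : Matrix R Q (ZMod 2)) (T : Finset Q)
    (hinj : ∀ z ∈ rowSpace H, (∀ q ∈ T, z q = 0) → z = 0) :
    ∃ I : Finset Q, I ⊆ T ∧
      Function.Bijective (fun z : rowSpace H => fun i : {q // q ∈ I} => (z : Q → ZMod 2) i.1) := by
  classical
  obtain ⟨I0, hI0T, -, hsp, hli⟩ :=
    exists_linearIndepOn_extension (linearIndepOn_empty (ZMod 2) H.col) (Set.empty_subset (T : Set Q))
  have hsp' : ∀ q ∈ T, H.col q ∈ Submodule.span (ZMod 2) (H.col '' I0) := fun q hq => hsp ⟨q, hq, rfl⟩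
  let I : Finset Q := I0.toFinset
  have hmemI : ∀ q, q ∈ I ↔ q ∈ I0 := fun q => Set.mem_toFinset
  have hIT : I ⊆ T := fun q hq => by
    have := hI0T ((hmemI q).1 hq); simpa using this
  refine ⟨I, hIT, ?_, ?_⟩
  · -- injective: a difference vanishing on I0 vanishes on span (col '' I0) ∋ col q (q ∈ T), hence on T, hence is 0
    intro z z' hzz'
    apply Subtype.ext
    have hmem : (z : Q → ZMod 2) - (z' : Q → ZMod 2) ∈ rowSpace H := Submodule.sub_mem _ z.2 z'.2
    obtain ⟨c, hc⟩ := (mem_rowSpace_iff H _).1 hmem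
    let L : (R → ZMod 2) →ₗ[ZMod 2] ZMod 2 :=
      { toFun := fun w => c ⬝ᵥ w
        map_add' := fun x y => dotProduct_add c x y
        map_smul' := fun a x => by rw [dotProduct_smul]; rfl }
    have hL : ∀ i ∈ I0, L (H.col i) = 0 := by
      intro i hi
      change c ⬝ᵥ H.col i = 0
      rw [← vecMul_eq_dotProduct_col, hc]
      have := congr_fun hzz' ⟨i, (hmemI i).2 hi⟩
      change (z : Q → ZMod 2) i = (z' : Q → ZMod 2) i at this
      rw [Pi.sub_apply, this, sub_self]
    have hLspan : Submodule.span (ZMod 2) (H.col '' I0) ≤ LinearMap.ker L := by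
      rw [Submodule.span_le]
      rintro _ ⟨i, hi, rfl⟩
      exact hL i hi
    have hzeroT : ∀ q ∈ T, ((z : Q → ZMod 2) - (z' : Q → ZMod 2)) q = 0 := by
      intro q hq
      rw [← hc, vecMul_eq_dotProduct_col]
      exact hLspan (hsp' q hq)
    exact sub_eq_zero.1 (hinj _ hmem hzeroT)
  · -- surjective: the columns indexed by I0 are independent, so `c ↦ (c · col i)_{i ∈ I}` hits everything
    intro y
    -- the matrix of the chosen columns
    let M : Matrix R {q // q ∈ I} (ZMod 2) := fun r i => H r i.1
    have hliM : LinearIndependent (ZMod 2) M.col := by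
      have hcol : M.col = fun i : {q // q ∈ I} => H.col i.1 := by
        funext i r; rfl
      rw [hcol]
      have hli' : LinearIndependent (ZMod 2) (fun i : I0 => H.col i.1) := hli.linearIndependent
      exact hli'.comp (fun i : {q // q ∈ I} => (⟨i.1, (hmemI i.1).1 i.2⟩ : I0))
        (fun a b hab => Subtype.ext (by simpa using congrArg Subtype.val hab))
    have hrank : M.rank = Fintype.card {q // q ∈ I} := by
      rw [rank_eq_finrank_span_cols, finrank_span_eq_card hliM]
    have htop : rowSpace M = ⊤ := by
      apply Submodule.eq_top_of_finrank_eq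
      rw [finrank_rowSpace_eq_rank, hrank, Module.finrank_fintype_fun_eq_card]
    have hy : y ∈ rowSpace M := by rw [htop]; exact Submodule.mem_top
    obtain ⟨c, hc⟩ := (mem_rowSpace_iff M y).1 hy
    refine ⟨⟨c ᵥ* H, (mem_rowSpace_iff H _).2 ⟨c, rfl⟩⟩, ?_⟩
    funext i
    change (c ᵥ* H) i.1 = y i
    rw [← hc]
    rfl

omit [DecidableEq Q] in
/-- An information set (bijective restriction) has `|I| = rank H`. [folklore] -/
theorem card_eq_rank_of_bij (H : Matrix R Q (ZMod 2)) (I : Finset Q)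
    (hbij : Function.Bijective (fun z : rowSpace H => fun i : {q // q ∈ I} => (z : Q → ZMod 2) i.1)) :
    I.card = H.rank := by
  let ρ : rowSpace H →ₗ[ZMod 2] ({q // q ∈ I} → ZMod 2) :=
    { toFun := fun z => fun i => (z : Q → ZMod 2) i.1
      map_add' := fun _ _ => rfl
      map_smul' := fun _ _ => rfl }
  have e : rowSpace H ≃ₗ[ZMod 2] ({q // q ∈ I} → ZMod 2) := LinearEquiv.ofBijective ρ hbij
  have h := e.finrank_eq
  rw [finrank_rowSpace_eq_rank, Module.finrank_fintype_fun_eq_card, Fintype.card_coe] at h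
  exact h.symm

end InfoSet

section SysCode

variable {Q : Type*} [Fintype Q] [DecidableEq Q]

omit [Fintype RX] in
/-- **Systematic form for a GIVEN information set** (qec-type-02's `exists_reindex_rowSpZ_eq_sysCode`, with the information set as an
input instead of an output). [folklore] -/
theorem rowSpZ_reindex_eq_sysCode_of_bij (C : CSSCode RX RZ Q) (I : Finset Q)
    (hbij : Function.Bijective (fun z : C.rowSpZ => fun i : {q // q ∈ I} => (z : Q → ZMod 2) i.1)) :
    ∃ A : Matrix {q // q ∈ I} {q // q ∉ I} (ZMod 2),
      (C.reindex (Equiv.refl RX) (Equiv.refl RZ) (Equiv.sumCompl fun q => q ∈ I).symm).rowSpZ = sysCode A := by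
  classical
  let ρ : C.rowSpZ →ₗ[ZMod 2] ({q // q ∈ I} → ZMod 2) :=
    { toFun := fun z => fun i => (z : Q → ZMod 2) i.1
      map_add' := fun _ _ => rfl
      map_smul' := fun _ _ => rfl }
  let e : C.rowSpZ ≃ₗ[ZMod 2] ({q // q ∈ I} → ZMod 2) := LinearEquiv.ofBijective ρ hbij
  have he : ∀ z : C.rowSpZ, ∀ i : {q // q ∈ I}, (z : Q → ZMod 2) i.1 = e z i := fun _ _ => rfl
  let A : Matrix {q // q ∈ I} {q // q ∉ I} (ZMod 2) := fun i j => (e.symm (Pi.single i 1) : Q → ZMod 2) j.1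
  have hgraph : ∀ z : C.rowSpZ, ∀ j : {q // q ∉ I},
      (z : Q → ZMod 2) j.1 = ∑ i, (z : Q → ZMod 2) i.1 * A i j := by
    intro z j
    have hz : z = e.symm (e z) := (e.symm_apply_apply z).symm
    have hsum : e z = ∑ i, (e z i) • (Pi.single i 1 : {q // q ∈ I} → ZMod 2) := by
      funext i'
      rw [Finset.sum_apply, Finset.sum_eq_single i']
      · simp
      · intro b _ hb
        simp [Ne.symm hb]
      · intro h; exact (h (Finset.mem_univ _)).elim
    conv_lhs => rw [hz, hsum, map_sum]
    rw [Submodule.coe_sum, Finset.sum_apply]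
    refine Finset.sum_congr rfl fun i _ => ?_
    rw [map_smul, Submodule.coe_smul, Pi.smul_apply, smul_eq_mul, ← he]
  refine ⟨A, Submodule.ext fun v => ?_⟩
  rw [CSSCode.mem_rowSpZ_reindex_iff, mem_sysCode_iff]
  constructor
  · intro hv j
    have h := hgraph ⟨_, hv⟩ j
    simp only [Function.comp_apply, Equiv.sumCompl_symm_apply_neg j] at h
    rw [h]
    refine Finset.sum_congr rfl fun i _ => ?_
    simp [Equiv.sumCompl_symm_apply_pos i]
  · intro hv
    let x : {q // q ∈ I} → ZMod 2 := fun i => v (Sum.inl i)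
    let w : C.rowSpZ := e.symm x
    have hwI : ∀ i : {q // q ∈ I}, (w : Q → ZMod 2) i.1 = v (Sum.inl i) := by
      intro i
      rw [he, LinearEquiv.apply_symm_apply]
    suffices hvw : v ∘ (Equiv.sumCompl fun q => q ∈ I).symm = (w : Q → ZMod 2) by
      rw [hvw]; exact w.2
    funext q
    by_cases hq : q ∈ I
    · simp only [Function.comp_apply, Equiv.sumCompl_symm_apply_of_pos hq]
      exact (hwI ⟨q, hq⟩).symm
    · simp only [Function.comp_apply, Equiv.sumCompl_symm_apply_of_neg hq]
      rw [hv ⟨q, hq⟩, hgraph w ⟨q, hq⟩]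
      refine Finset.sum_congr rfl fun i _ => ?_
      rw [hwI]

end SysCode

section MinWeight

variable {Q : Type*} [Fintype Q] [DecidableEq Q]

omit [Fintype RX] in
/-- **A minimum-weight `Z`-logical contains no nonzero `Z`-stabilizer in its support**; equivalently the restriction of `rs H^Z` to the
zero set of `x` is injective. [folklore] -/
theorem restrict_injective_of_minWeight (C : CSSCode RX RZ Q) {x : Q → ZMod 2} (hx : C.HX *ᵥ x = 0) (hx' : x ∉ C.rowSpZ)
    (hmin : hammingNorm x = C.dZ) :
    ∀ z ∈ C.rowSpZ, (∀ q, x q = 0 → z q = 0) → z = 0 := by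
  classical
  intro z hz hzero
  by_contra hne
  have hF2 : ∀ a : ZMod 2, a ≠ 0 → a = 1 := by decide
  -- `x + z` is a lighter `Z`-logical
  have h1 : C.HX *ᵥ (x + z) = 0 := by
    rw [mulVec_add, hx, zero_add]
    exact (C.mem_kerX_iff _).1 (C.rowSpZ_le_kerX hz)
  have h2 : x + z ∉ C.rowSpZ := fun h => hx' (by
    have := Submodule.sub_mem _ h hz
    simpa using this)
  have hsupp : (univ.filter fun q => (x + z) q ≠ 0) ⊆ (univ.filter fun q => x q ≠ 0) \ (univ.filter fun q => z q ≠ 0) := by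
    intro q hq
    simp only [Finset.mem_sdiff, Finset.mem_filter, Finset.mem_univ, true_and, Pi.add_apply] at hq ⊢
    by_cases hxq : x q = 0
    · exact absurd (by rw [hxq, hzero q hxq, add_zero]) hq
    · refine ⟨hxq, fun hzq => hq ?_⟩
      rw [hF2 _ hxq, hF2 _ hzq]; decide
  obtain ⟨q0, hq0⟩ : ∃ q, z q ≠ 0 := by
    by_contra h; push Not at h; exact hne (funext h)
  have hxq0 : x q0 ≠ 0 := fun h => hq0 (hzero q0 h)
  have hlt : hammingNorm (x + z) < hammingNorm x := by
    unfold hammingNorm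
    calc #(univ.filter fun q => (x + z) q ≠ 0)
        ≤ #((univ.filter fun q => x q ≠ 0) \ (univ.filter fun q => z q ≠ 0)) := Finset.card_le_card hsupp
      _ < #(univ.filter fun q => x q ≠ 0) := by
          apply Finset.card_lt_card
          refine Finset.ssubset_iff_subset_ne.2 ⟨Finset.sdiff_subset, fun h => ?_⟩
          have : q0 ∈ (univ.filter fun q => x q ≠ 0) \ (univ.filter fun q => z q ≠ 0) := by rw [h]; simpa using hxq0
          simp [hq0] at this
  have := C.dZ_le_hammingNorm h1 h2
  omega

omit [DecidableEq Q] in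
/-- **Two `Z`-logicals of a `k = 1` code differ by a `Z`-stabilizer** (`[ker H^X : rs H^Z] = 2`). [folklore] -/
theorem index_two (C : CSSCode RX RZ Q) (hk : C.k = 1) {y y' : Q → ZMod 2}
    (hy : C.HX *ᵥ y = 0) (hy' : y ∉ C.rowSpZ) (hz : C.HX *ᵥ y' = 0) (hz' : y' ∉ C.rowSpZ) : y + y' ∈ C.rowSpZ := by
  classical
  have hkZ : Module.finrank (ZMod 2) C.kerX = Module.finrank (ZMod 2) C.rowSpZ + 1 := by
    have h := C.k_swap
    rw [hk] at h
    change Module.finrank (ZMod 2) C.swap.kerZ - Module.finrank (ZMod 2) C.swap.rowSpX = 1 at h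
    have hle := Submodule.finrank_mono C.swap.rowSpX_le_kerZ
    change Module.finrank (ZMod 2) C.rowSpZ ≤ Module.finrank (ZMod 2) C.kerX at hle
    change Module.finrank (ZMod 2) C.kerX - Module.finrank (ZMod 2) C.rowSpZ = 1 at h
    omega
  have hyK : y ∈ C.kerX := (C.mem_kerX_iff _).2 hy
  have hy'K : y' ∈ C.kerX := (C.mem_kerX_iff _).2 hz
  -- W := rs H^Z ⊔ span {y'} equals ker H^X
  let W : Submodule (ZMod 2) (Q → ZMod 2) := C.rowSpZ ⊔ (ZMod 2) ∙ y'
  have hWle : W ≤ C.kerX := sup_le C.rowSpZ_le_kerX ((Submodule.span_singleton_le_iff_mem _ _).2 hy'K)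
  have hlt : C.rowSpZ < W := by
    refine lt_of_le_of_ne le_sup_left fun h => hz' ?_
    rw [h]; exact Submodule.mem_sup_right (Submodule.mem_span_singleton_self _)
  have hWfin : Module.finrank (ZMod 2) C.kerX ≤ Module.finrank (ZMod 2) W := by
    have := Submodule.finrank_lt_finrank_of_lt hlt
    omega
  have hWeq : W = C.kerX := Submodule.eq_of_le_of_finrank_le hWle hWfin
  have hyW : y ∈ W := by rw [hWeq]; exact hyK
  obtain ⟨r, hr, t, ht, hsum⟩ := Submodule.mem_sup.1 hyW
  obtain ⟨a, rfl⟩ := Submodule.mem_span_singleton.1 ht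
  have ha : a = 0 ∨ a = 1 := by
    have : ∀ a : ZMod 2, a = 0 ∨ a = 1 := by decide
    exact this a
  rcases ha with rfl | rfl
  · exfalso; apply hy'
    rw [← hsum, zero_smul, add_zero]; exact hr
  · rw [one_smul] at hsum
    have : y + y' = r + (y' + y') := by rw [← hsum]; abel
    rw [this, show y' + y' = 0 from by funext q; simpa using (by decide : ∀ a : ZMod 2, a + a = 0) (y' q), add_zero]
    exact hr

end MinWeight

end Summit.Ventures.QEC.Census.CSSNormalForm
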